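import Mathlib
import Literature.AlgebraicGeometry.Resolution.AugmentationIdeal
import Literature.AlgebraicGeometry.Resolution.AffineBlowupAlgebra
import Literature.AlgebraicGeometry.Resolution.BlowupLiftsCongruence
import Literature.AlgebraicGeometry.Resolution.BlowupPrincipalCharts
import Literature.AlgebraicGeometry.Resolution.ProjectiveSpaceRegular
import Summits.ResolutionOfSingularities.ResolutionOfSingularities.Theorems.FrobeniusClosingPatchingRelPerfectCoreRungSquarePlusLinearCharts
import Summits.ResolutionOfSingularities.ResolutionOfSingularities.Theorems.WildQuotientsWildQuotientResolutionToricExitJordanThreeBrickRegular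
import Summits.ResolutionOfSingularities.ResolutionOfSingularities.Theorems.WildQuotientsWildQuotientResolutionInvolutionFixedLocusRegularGlobal

/-!
# The Rees charts of the blow-up of a regular centre are regular rings; the involution chart (card `mu2-strata-kl-twice`)

(crux stmt-ResolutionOfSingularities-15640 `WildQuotients.WildQuotientResolution`, line `Sketch`,
sector `|G| = p`; RUNG V5 of `L/w45c/CHAIN.md` v8.3, brick B7/`HP₂`; res-L1-w45c-plan-1 ORDER
2026-08-27T12:24:13Z (2)+(3) — «the `[IsRegularRing U]` instance 036's (ε) feeds to H5
`isRegularRing_fixedPoints_of_involution` on H4's `involutionChartTerminal` carrier».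
[OURS · L1 W4.5c] — NOT a statement of any manuscript; replaces the role of no printed item.
Prover res-L1-w45c-stub-3.)

* `BlowupExit.isRegularRing_blowupAlgebra_of_isRegularRing_quotient` — **for a regular ring `R` and
  an ideal `I` with `R ⧸ I` regular, every affine blowup algebra `R[I/y]` (`y ∈ I`) is a regular ring**:
  `Bl_I(Spec R)` is regular (Liu 8.1.19 (a), tree
  `…Theorems.isRegular_of_isBlowup_idealSheaf_of_quotient`), its principal chart `V[y]` is affine
  (`IsBlowup.isAffineOpen_blowupChart`) with coordinate ring `≅ R[I/y]`
  (`IsBlowup.exists_ringEquiv_blowupChart` + the `ΓSpecIso` transport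
  `BlowupExit.isRegularRing_blowupAlgebra_map_of_ringEquiv`), and an affine open of a locally
  Noetherian regular scheme has a regular coordinate ring (`Scheme.IsRegular.isRegularRing_of_isAffineOpen`).
* `InvolutionExit.adjoin_ratio_eq_blowupAlgebra` — the carrier of res-type-036's H4 chart
  (`Algebra.adjoin R {q | ∃ b ∈ I_ι, q·y = b} ⊆ R[1/y]`) IS `blowupAlgebra (augIdeal ι) y` (the two
  generator sets coincide, `y` being a unit of `R[1/y]`); stated for any ideal.
* `InvolutionExit.isRegularRing_involutionChart` — (1)+(2)+(3): for a regular ring `R`, an involution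
  `ι` with `2 ∈ Rˣ` and `y ∈ I_ι`, the chart ring `R[I_ι/y]` (in H4's spelling) is a regular ring —
  the `[IsRegularRing U]` input of H5 on every chart of `Bl_{I_ι}`.
-/

-- single-problem summit: the doubled namespace component `ResolutionOfSingularities` is forced
set_option linter.dupNamespace false

noncomputable section

open CategoryTheory AlgebraicGeometry TopologicalSpace IsLocalization
open Literature.AlgebraicGeometry.Resolution

namespace Summit.ResolutionOfSingularities.ResolutionOfSingularities.Theorems.WildQuotientResolution.BlowupExit

/-- **Affine blowup algebras of a regular centre in a regular ring are regular**: `R` regular,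
`R ⧸ I` regular, `y ∈ I` ⇒ `R[I/y]` is a regular ring. [OURS · L1 W4.5c] [cite: Liu2002, Thm. 8.1.19 (a)] -/
theorem isRegularRing_blowupAlgebra_of_isRegularRing_quotient {R : Type} [CommRing R]
    [IsRegularRing R] (I : Ideal R) [IsRegularRing (R ⧸ I)] {y : R} (hy : y ∈ I) :
    IsRegularRing (blowupAlgebra I y) := by
  set V := affineBlowup I with hV
  have hπ : IsBlowup (affineBlowup.π I) (affineBlowup.idealSheaf I) := affineBlowup.isBlowup I
  have hreg : Scheme.IsRegular V :=
    Summit.ResolutionOfSingularities.ResolutionOfSingularities.Theorems.isRegular_of_isBlowup_idealSheaf_of_quotient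
      I hπ
  haveI : IsLocallyNoetherian V := LocallyOfFiniteType.isLocallyNoetherian (affineBlowup.π I)
  have hIdeal : (affineBlowup.idealSheaf I).ideal ⟨⊤, isAffineOpen_top _⟩ =
      I.map (Scheme.ΓSpecIso (CommRingCat.of R)).inv.hom := by
    change (Scheme.IdealSheafData.ofIdealTop _).ideal ⟨⊤, isAffineOpen_top _⟩ = _
    rw [ideal_ofIdealTop_top]
  have hy' : (Scheme.ΓSpecIso (CommRingCat.of R)).inv.hom y ∈
      (affineBlowup.idealSheaf I).ideal ⟨⊤, isAffineOpen_top _⟩ := by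
    rw [hIdeal]; exact Ideal.mem_map_of_mem _ hy
  -- the principal chart `V[y]` is affine with regular coordinate ring
  have hU : IsAffineOpen (blowupChart (affineBlowup.π I) (affineBlowup.idealSheaf I)
      ⟨⊤, isAffineOpen_top _⟩ ((Scheme.ΓSpecIso (CommRingCat.of R)).inv.hom y)) :=
    hπ.isAffineOpen_blowupChart hy'
  have hΓ := hreg.isRegularRing_of_isAffineOpen hU
  obtain ⟨e, -⟩ := hπ.exists_ringEquiv_blowupChart ⟨⊤, isAffineOpen_top _⟩ hy'
  haveI := hΓ
  have h1 : IsRegularRing (blowupAlgebra ((affineBlowup.idealSheaf I).ideal ⟨⊤, isAffineOpen_top _⟩)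
      ((Scheme.ΓSpecIso (CommRingCat.of R)).inv.hom y)) := IsRegularRing.of_ringEquiv e
  rw [hIdeal] at h1
  -- transport back along `Γ(Spec R, ⊤) ≅ R`
  have h2 := isRegularRing_blowupAlgebra_map_of_ringEquiv
    (Scheme.ΓSpecIso (CommRingCat.of R)).commRingCatIsoToRingEquiv
    (Scheme.ΓSpecIso (CommRingCat.of R)).hom.hom (fun _ => rfl)
    (I.map (Scheme.ΓSpecIso (CommRingCat.of R)).inv.hom)
    ((Scheme.ΓSpecIso (CommRingCat.of R)).inv.hom y) h1
  have hcomp : ((Scheme.ΓSpecIso (CommRingCat.of R)).hom.hom).comp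
      (Scheme.ΓSpecIso (CommRingCat.of R)).inv.hom = RingHom.id R := by
    ext r
    change ((Scheme.ΓSpecIso (CommRingCat.of R)).inv ≫ (Scheme.ΓSpecIso (CommRingCat.of R)).hom).hom r = r
    rw [Iso.inv_hom_id]
    rfl
  have hmap : (I.map (Scheme.ΓSpecIso (CommRingCat.of R)).inv.hom).map
      (Scheme.ΓSpecIso (CommRingCat.of R)).hom.hom = I := by
    rw [Ideal.map_map, hcomp, Ideal.map_id]
  have hyy : (Scheme.ΓSpecIso (CommRingCat.of R)).hom.hom
      ((Scheme.ΓSpecIso (CommRingCat.of R)).inv.hom y) = y := DFunLike.congr_fun hcomp y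
  rw [hmap, hyy] at h2
  exact h2

end Summit.ResolutionOfSingularities.ResolutionOfSingularities.Theorems.WildQuotientResolution.BlowupExit

namespace Summit.ResolutionOfSingularities.ResolutionOfSingularities.Theorems.WildQuotientResolution.InvolutionExit

/-- **The involution chart is an affine blowup algebra**: for any ideal `I` and any `y`, the
`R`-subalgebra of `R[1/y]` generated by the ratios `{q | ∃ b ∈ I, q·y = b}` (res-type-036's H4
carrier for `I = I_ι`) equals `blowupAlgebra I y = R[I/y]`. [OURS · L1 W4.5c] [folklore] -/
theorem adjoin_ratio_eq_blowupAlgebra {R : Type} [CommRing R] (I : Ideal R) (y : R) :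
    Algebra.adjoin R {q : Localization.Away y | ∃ b ∈ I,
        q * algebraMap R (Localization.Away y) y = algebraMap R (Localization.Away y) b} =
      blowupAlgebra I y := by
  have hset : {q : Localization.Away y | ∃ b ∈ I,
      q * algebraMap R (Localization.Away y) y = algebraMap R (Localization.Away y) b} =
      blowupAlgebraGens I y := by
    ext q
    simp only [Set.mem_setOf_eq, blowupAlgebraGens]
    constructor
    · rintro ⟨b, hb, hq⟩
      refine ⟨b, hb, ?_⟩
      rw [← hq, mul_assoc, Away.mul_invSelf, mul_one]
    · rintro ⟨b, hb, rfl⟩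
      exact ⟨b, hb, div_mul_algebraMap y b⟩
  rw [hset]
  rfl

/-- **The involution chart ring is regular** (ORDER (1)+(2)+(3)): for a regular ring `R`, an
involution `ι` with `2 ∈ Rˣ` and `y ∈ I_ι`, the chart ring `R[I_ι/y]` of `Bl_{I_ι}(Spec R)` — in
res-type-036's H4 spelling — is a regular ring: the `[IsRegularRing U]` input of H5
(`isRegularRing_fixedPoints_of_involution`) on every chart. [OURS · L1 W4.5c, card
`mu2-strata-kl-twice`] [folklore] -/
theorem isRegularRing_involutionChart {R : Type} [CommRing R] [IsRegularRing R] (ι : R ≃+* R)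
    (hι : ∀ x, ι (ι x) = x) (h2 : IsUnit (2 : R)) {y : R} (hyI : y ∈ augIdeal ι) :
    IsRegularRing (Algebra.adjoin R {q : Localization.Away y | ∃ b ∈ augIdeal ι,
        q * algebraMap R (Localization.Away y) y = algebraMap R (Localization.Away y) b}) := by
  haveI : IsRegularRing (R ⧸ augIdeal ι) := isRegularRing_quotient_augIdeal ι hι h2
  rw [adjoin_ratio_eq_blowupAlgebra]
  exact BlowupExit.isRegularRing_blowupAlgebra_of_isRegularRing_quotient (augIdeal ι) hyI

end Summit.ResolutionOfSingularities.ResolutionOfSingularities.Theorems.WildQuotientResolution.InvolutionExit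

end
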